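import Mathlib
import Summits.Ventures.PercRepro2.TypedBundleHarris
import Summits.Ventures.PercRepro2.TypedPocketOA2Theorem

/-!
# The domain of record without the (HARRIS-2) b-pocket classes (blind cell PercRepro2, p2 g7,
2026-08-26; sub-claim S1 — p3 g7/g8's (HARRIS-2) class composed on the eighteen-condition layer; the
lead's RULING 1 (ii) of 00:44:30Z, R-SEP3(6))

p3 g8's `PocketOA2.typedCount_nonneg_of_hasPocketOA2` (the doors `o, a₂` separate `b` from `{a₁, a₃}` —
the b-pocket on the mark `o` and the root `a₂`; the typed-Harris-with-spectator certificate on the 5 × 15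
side decomposition) and its root mirror `typedCount_nonneg_of_hasPocketOA2_mirror` (the doors `o, a₁`),
composed on TypedBundleHarris.lean in the `by_cases` pattern of every layer:

* **`ResidualCoreNHatCTBRASUDO7SP2H := ResidualCoreNHatCTBRASUDO7SP2H1 ∧ ¬HasPocketOA2 ∧
  ¬HasPocketOA2(roots swapped)`**, **`HCov_all_of_residualCoreNHatCTBRASUDO7SP2H_all`**;
* the flat form **`FlatDomain7SP2H_all`** (twenty conditions), **`HCov_all_of_flat7SP2H_all`** —
  UNCONDITIONAL.

Own code; standard axioms.
-/

namespace Summit.Ventures.PercRepro2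

open UnionCluster

namespace CovForm

namespace TypedRed

section CoreHarris2

variable {V : Type*} {E : Type*} [DecidableEq V] [Fintype E] [DecidableEq E]

/-- **The domain of record without the four Harris pocket classes** (the b-pocket doors `{o, a₂}` and
`{o, a₁}` as well). -/
structure ResidualCoreNHatCTBRASUDO7SP2H (ends : E → Sym2 V) (o a₁ a₂ a₃ b : V) (F : Finset E) :
    Prop where
  coreNHatCTBRASUDO7SP2H1 : ResidualCoreNHatCTBRASUDO7SP2H1 ends o a₁ a₂ a₃ b F
  not_pocketOA2 : ¬ PocketOA2.HasPocketOA2 ends o a₁ a₂ a₃ b F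
  not_pocketOA2_mirror : ¬ PocketOA2.HasPocketOA2 ends o a₂ a₁ a₃ b F

end CoreHarris2

section ClosureHarris2

variable (R : Type*) [Field R] [LinearOrder R] [IsStrictOrderedRing R]

/-- **Row 2′TRI on `ResidualCoreNHatCTBRASUDO7SP2H`, over every finite graph.** -/
def ResidualCoreNHatCTBRASUDO7SP2H_all : Prop :=
  ∀ (V E : Type) [Fintype V] [DecidableEq V] [Fintype E] [DecidableEq E]
    (ends : E → Sym2 V) (o a₁ a₂ a₃ b : V) (F : Finset E) (τ : E → ℕ),
    (∀ e ∈ F, τ e = 1 ∨ τ e = 2) → ResidualCoreNHatCTBRASUDO7SP2H ends o a₁ a₂ a₃ b F →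
      0 ≤ typedCount F (fun _ => false) τ
        (K3 ends o a₁ a₂ a₃ b : Config E → Config E → Config E → R)

/-- **THE CRUX OF RECORD FROM (TRI) ON THE DOMAIN WITHOUT THE FOUR HARRIS POCKET CLASSES** —
unconditional. -/
theorem HCov_all_of_residualCoreNHatCTBRASUDO7SP2H_all
    (hc : ResidualCoreNHatCTBRASUDO7SP2H_all R) : HCov_all R := by
  refine HCov_all_of_residualCoreNHatCTBRASUDO7SP2H1_all R ?_
  intro V E _ _ _ _ ends o a₁ a₂ a₃ b F τ hτ hdom
  by_cases hp : PocketOA2.HasPocketOA2 ends o a₁ a₂ a₃ b F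
  · exact PocketOA2.typedCount_nonneg_of_hasPocketOA2 ends o a₁ a₂ a₃ b F τ hτ hp
  by_cases hp' : PocketOA2.HasPocketOA2 ends o a₂ a₁ a₃ b F
  · exact PocketOA2.typedCount_nonneg_of_hasPocketOA2_mirror ends o a₁ a₂ a₃ b F τ hτ hp'
  exact hc V E ends o a₁ a₂ a₃ b F τ hτ ⟨hdom, hp, hp'⟩

/-- **Row 2′TRI on the flat domain without the four Harris pocket classes, over every finite graph**
(twenty conditions). -/
def FlatDomain7SP2H_all : Prop :=
  ∀ (V E : Type) [Fintype V] [DecidableEq V] [Fintype E] [DecidableEq E]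
    (ends : E → Sym2 V) (o a₁ a₂ a₃ b : V) (F : Finset E) (τ : E → ℕ),
    (∀ e ∈ F, τ e = 1 ∨ τ e = 2) →
    ResidualCore ends o a₁ a₂ a₃ b F →
    ¬ Hats ends o a₁ a₂ a₃ b F →
    ¬ HasRootCut ends o a₁ a₂ a₃ b F →
    ¬ HasTwoTerminalPart ends o a₁ a₂ a₃ b F →
    ¬ HasRootBundle ends o a₁ a₂ a₃ b F →
    ¬ RootBridge.HasCutRoots ends o a₁ a₂ a₃ b F →
    ¬ RootBridge.HasCutRootsA3 ends o a₁ a₂ a₃ b F →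
    ¬ OneStar ends o a₁ a₂ a₃ b F →
    ¬ RootBridge.MildInst ends o a₁ a₂ a₃ b F (fun _ => false) →
    o ≠ b →
    ¬ RootBridge.OBehindA3 ends o a₁ a₂ a₃ F (fun _ => false) →
    7 ≤ F.card →
    ¬ SepThree.HasSepThree ends o a₁ a₂ a₃ b F →
    ¬ SepThree.HasSepThree ends o a₂ a₁ a₃ b F →
    ¬ PocketAB.HasPocketAB ends o a₁ a₂ a₃ b F →
    ¬ SepTwo.HasSepTwo ends o a₁ a₂ a₃ b F →
    ¬ PocketA1B.HasPocketA1B ends o a₁ a₂ a₃ b F →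
    ¬ PocketA1B.HasPocketA1B ends o a₂ a₁ a₃ b F →
    ¬ PocketOA2.HasPocketOA2 ends o a₁ a₂ a₃ b F →
    ¬ PocketOA2.HasPocketOA2 ends o a₂ a₁ a₃ b F →
      0 ≤ typedCount F (fun _ => false) τ
        (K3 ends o a₁ a₂ a₃ b : Config E → Config E → Config E → R)

/-- **THE CRUX OF RECORD FROM (TRI) ON THE FLAT DOMAIN WITHOUT THE FOUR HARRIS POCKET CLASSES** —
the sentence of record in one statement, twenty conditions. -/
theorem HCov_all_of_flat7SP2H_all (hc : FlatDomain7SP2H_all R) : HCov_all R := by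
  refine HCov_all_of_residualCoreNHatCTBRASUDO7SP2H_all R ?_
  intro V E _ _ _ _ ends o a₁ a₂ a₃ b F τ hτ hdom
  obtain ⟨h0, h1, h2, h3, h4, h5, h6, h7, h8, h9, h10⟩ :=
    (ResidualCoreNHatCTBRASUDO_iff ends o a₁ a₂ a₃ b F).1
      hdom.coreNHatCTBRASUDO7SP2H1.coreNHatCTBRASUDO7SP2.coreNHatCTBRASUDO7SP.coreNHatCTBRASUDO7S.coreNHatCTBRASUDO7.coreNHatCTBRASUDO
  exact hc V E ends o a₁ a₂ a₃ b F τ hτ h0 h1 h2 h3 h4 h5 h6 h7 h8 h9 h10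
    hdom.coreNHatCTBRASUDO7SP2H1.coreNHatCTBRASUDO7SP2.coreNHatCTBRASUDO7SP.coreNHatCTBRASUDO7S.coreNHatCTBRASUDO7.seven_le
    hdom.coreNHatCTBRASUDO7SP2H1.coreNHatCTBRASUDO7SP2.coreNHatCTBRASUDO7SP.coreNHatCTBRASUDO7S.not_sepThree
    hdom.coreNHatCTBRASUDO7SP2H1.coreNHatCTBRASUDO7SP2.coreNHatCTBRASUDO7SP.coreNHatCTBRASUDO7S.not_sepThree_mirror
    hdom.coreNHatCTBRASUDO7SP2H1.coreNHatCTBRASUDO7SP2.coreNHatCTBRASUDO7SP.not_pocketAB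
    hdom.coreNHatCTBRASUDO7SP2H1.coreNHatCTBRASUDO7SP2.not_sepTwo
    hdom.coreNHatCTBRASUDO7SP2H1.not_pocketA1B hdom.coreNHatCTBRASUDO7SP2H1.not_pocketA1B_mirror
    hdom.not_pocketOA2 hdom.not_pocketOA2_mirror

end ClosureHarris2

end TypedRed

end CovForm

end Summit.Ventures.PercRepro2
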